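import Mathlib
import Literature.Geometry.Lorentzian.BilinPullbackEstimates
import HarnessLib
import Literature.Uncategorized.BilinPullbackNearIdConst

/-!
# W2 — pull-back of a constant bilinear form along a `C³`-near-identity self-map of `E4`

For a constant field of continuous bilinear forms `y ↦ β` on `E4` and a self-map `S = id + P` of
`E4` with `P` of class `C³` on an open set `U ∋ x` and `‖Dʲ P(x)‖ ≤ ε ≤ 1` for `j = 1, 2, 3`, the
coordinate pullback `bilinPullback S β` (`Literature.Geometry.Lorentzian.bilinPullback`) satisfies
`‖Dᵐ (bilinPullback S β − β)(x)‖ ≤ 8 ‖β‖ ε` for `m ≤ 2`.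

Main declarations: `BilinPullbackNearIdConst` (the statement registered as stub W2 of the
`NeckGapDecay` skeleton, verbatim) and `stub_bilinPullbackNearIdConst : Literature.Uncategorized.BilinPullbackNearIdConst`.

Proof (pure Mathlib, following `norm_iteratedFDeriv_bilinPullback_le`; carried out for a general
real normed space `E` and specialised to `E4` at the end): on `U` the Jacobian of `S` is
`DS = 1 + Q`, `Q := DP` (`HasFDerivAt.add`), so on `U`
`bilinPullback S β − β = A₁ Q + A₂ Q + (A₃ Q) ∘ (A₂ Q)` with the FIXED continuous linear maps
`A₁ = precompL E β.flip` (`L ↦ β(·, L ·)`), `A₂ = compL β` (`L ↦ β(L ·, ·)`) and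
`A₃ = (compL).flip` (`L ↦ precomp L`), of operator norms `≤ ‖β‖`, `≤ ‖β‖`, `≤ 1`.  The two sides
have the same iterated derivatives at `x` (`Filter.EventuallyEq.iteratedFDeriv`); the first two
terms have `‖Dᵐ(Aᵢ ∘ Q)(x)‖ ≤ ‖Aᵢ‖ ‖Dᵐ Q(x)‖ ≤ ‖β‖ ε`
(`ContinuousLinearMap.iteratedFDeriv_comp_left` and `‖Dᵐ Q(x)‖ = ‖Dᵐ⁺¹ P(x)‖`,
`norm_iteratedFDeriv_fderiv_of_isOpen`), and the third is bounded by the Leibniz rule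
`norm_iteratedFDeriv_clm_comp_le`: `≤ ∑ᵢ C(m, i) ε ‖β‖ ε = 2ᵐ ‖β‖ ε² ≤ 4 ‖β‖ ε`.
Total `≤ 6 ‖β‖ ε ≤ 8 ‖β‖ ε`.
-/

open Set Filter Topology Literature.Geometry.Lorentzian

namespace Summit.FinalStateConjecture.FinalStateConjecture.Theorems.NeckGapDecay.ConnectionLevelCones.BilinPullbackNearIdConstStub
set_option linter.dupNamespace false
-- Operator norms on the doubly nested space `(E →L E) →L (E →L (E →L ℝ))` need pending-instance
-- depth 2 (Mathlib's own build sets `maxSynthPendingDepth 3`; this project keeps core's default).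
set_option maxSynthPendingDepth 2

section General

variable {E : Type*} [NormedAddCommGroup E] [NormedSpace ℝ E]

/-- The algebra of the decomposition: for a bilinear form `β` and `L : E →L E`,
`β((1 + L) ·, (1 + L) ·) − β = β(·, L ·) + β(L ·, ·) + β(L ·, L ·)`, written with the fixed
continuous linear maps `precompL E β.flip`, `compL β` and `(compL).flip` applied to `L`.
[folklore] -/
private lemma precomp_comp_id_add_sub_eq (β : E →L[ℝ] E →L[ℝ] ℝ) (L : E →L[ℝ] E) :
    (ContinuousLinearMap.precomp ℝ (ContinuousLinearMap.id ℝ E + L)).comp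
        (β.comp (ContinuousLinearMap.id ℝ E + L)) - β =
      ContinuousLinearMap.precompL E β.flip L + ContinuousLinearMap.compL ℝ E E (E →L[ℝ] ℝ) β L +
        ((ContinuousLinearMap.compL ℝ E E ℝ).flip L).comp
          (ContinuousLinearMap.compL ℝ E E (E →L[ℝ] ℝ) β L) := by
  ext v w
  simp
  abel

/-- Sum rule for the iterated derivative of three `Cⁿ` functions at a point. [folklore] -/
private lemma iteratedFDeriv_add_three_apply {F G : Type*} [NormedAddCommGroup F]
    [NormedSpace ℝ F] [NormedAddCommGroup G] [NormedSpace ℝ G] {f g h : F → G} {x : F} {n : ℕ}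
    (hf : ContDiffAt ℝ n f x) (hg : ContDiffAt ℝ n g x) (hh : ContDiffAt ℝ n h x) :
    iteratedFDeriv ℝ n (fun y ↦ f y + g y + h y) x =
      iteratedFDeriv ℝ n f x + iteratedFDeriv ℝ n g x + iteratedFDeriv ℝ n h x := by
  have hfg : ContDiffAt ℝ n (f + g) x := hf.add hg
  have e : (fun y ↦ f y + g y + h y) = f + g + h := rfl
  rw [e, iteratedFDeriv_add_apply hfg hh, iteratedFDeriv_add_apply hf hg]

/-- Chain rule with a FIXED continuous linear map on the left, as a norm bound at a point of an
open set: `‖Dⁱ(A ∘ Q)(x)‖ ≤ ‖A‖ ‖Dⁱ Q(x)‖` for `i ≤ k` if `Q` is `Cᵏ` on the open set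
(`ContinuousLinearMap.iteratedFDeriv_comp_left`). [folklore] -/
private lemma norm_iteratedFDeriv_const_clm_comp_le {X G₁ G₂ : Type*} [NormedAddCommGroup X]
    [NormedSpace ℝ X] [NormedAddCommGroup G₁] [NormedSpace ℝ G₁] [NormedAddCommGroup G₂]
    [NormedSpace ℝ G₂] {Q : X → G₁} {s : Set X} (hs : IsOpen s) {k : ℕ}
    (hQ : ContDiffOn ℝ k Q s) (A : G₁ →L[ℝ] G₂) {x : X} (hx : x ∈ s) {i : ℕ} (hi : i ≤ k) :
    ‖iteratedFDeriv ℝ i (fun y ↦ A (Q y)) x‖ ≤ ‖A‖ * ‖iteratedFDeriv ℝ i Q x‖ := by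
  have hQx : ContDiffAt ℝ k Q x := hQ.contDiffAt (hs.mem_nhds hx)
  have e : (fun y ↦ A (Q y)) = A ∘ Q := rfl
  rw [e, A.iteratedFDeriv_comp_left hQx (by exact_mod_cast hi)]
  exact A.norm_compContinuousMultilinearMap_le _

/-- The Jacobian of the near-identity map: on the open set `U` where `P` is `C³`,
`D(id + P)(y) = 1 + DP(y)`. [folklore] -/
private lemma fderiv_id_add_eq {P : E → E} {U : Set E} (hU : IsOpen U)
    (hP : ContDiffOn ℝ 3 P U) {y : E} (hy : y ∈ U) :
    fderiv ℝ (fun z ↦ z + P z) y = ContinuousLinearMap.id ℝ E + fderiv ℝ P y := by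
  have hPd : DifferentiableAt ℝ P y :=
    (hP.contDiffAt (hU.mem_nhds hy)).differentiableAt (by norm_num)
  exact ((hasFDerivAt_id y).add hPd.hasFDerivAt).fderiv

/-- **The estimate, for a general real normed space `E`.**  With `Q := DP`, `DS = 1 + Q` on `U`,
so `bilinPullback S β − β = A₁ Q + A₂ Q + (A₃ Q) ∘ (A₂ Q)` there for fixed continuous linear maps
`A₁, A₂, A₃` of norms `≤ ‖β‖, ‖β‖, 1`; the linear terms contribute `≤ ‖β‖ ε` each
(`‖Dᵐ Q(x)‖ = ‖Dᵐ⁺¹ P(x)‖ ≤ ε`) and the bilinear one `≤ 2ᵐ ‖β‖ ε² ≤ 4 ‖β‖ ε` by the Leibniz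
rule; total `≤ 6 ‖β‖ ε ≤ 8 ‖β‖ ε`. [folklore] -/
private theorem norm_iteratedFDeriv_bilinPullback_id_add_const_sub_le (β : E →L[ℝ] E →L[ℝ] ℝ)
    {P : E → E} {U : Set E} {x : E} {ε : ℝ} (hU : IsOpen U) (hx : x ∈ U)
    (hP : ContDiffOn ℝ 3 P U) (hε0 : 0 ≤ ε) (hε1 : ε ≤ 1)
    (hPb : ∀ j, 1 ≤ j → j ≤ 3 → ‖iteratedFDeriv ℝ j P x‖ ≤ ε) {m : ℕ} (hm : m ≤ 2) :
    ‖iteratedFDeriv ℝ m (fun y ↦ bilinPullback (fun z ↦ z + P z) (fun _ ↦ β) y - β) x‖ ≤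
      8 * ‖β‖ * ε := by
  -- the players: the Jacobian `Q` of `P` and the three fixed continuous linear maps
  set Q : E → E →L[ℝ] E := fderiv ℝ P with hQdef
  set A₁ := ContinuousLinearMap.precompL E β.flip with hA₁
  set A₂ := ContinuousLinearMap.compL ℝ E E (E →L[ℝ] ℝ) β with hA₂
  set A₃ := (ContinuousLinearMap.compL ℝ E E ℝ).flip with hA₃
  -- operator norms of the fixed maps
  have hA₁n : ‖A₁‖ ≤ ‖β‖ :=
    (ContinuousLinearMap.norm_precompL_le E β.flip).trans_eq (ContinuousLinearMap.opNorm_flip β)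
  have hA₂n : ‖A₂‖ ≤ ‖β‖ :=
    (ContinuousLinearMap.le_opNorm _ β).trans
      (mul_le_of_le_one_left (norm_nonneg _) (ContinuousLinearMap.norm_compL_le _ _ _ _))
  have hA₃n : ‖A₃‖ ≤ 1 := by
    rw [hA₃, ContinuousLinearMap.opNorm_flip]
    exact ContinuousLinearMap.norm_compL_le _ _ _ _
  -- smoothness of `Q` and of the three terms on `U`
  have hQ : ContDiffOn ℝ (2 : ℕ) Q U := hP.fderiv_of_isOpen hU (by norm_num)
  have hT₁ : ContDiffOn ℝ (2 : ℕ) (fun y ↦ A₁ (Q y)) U := A₁.contDiff.comp_contDiffOn hQ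
  have hT₂ : ContDiffOn ℝ (2 : ℕ) (fun y ↦ A₂ (Q y)) U := A₂.contDiff.comp_contDiffOn hQ
  have hP₃ : ContDiffOn ℝ (2 : ℕ) (fun y ↦ A₃ (Q y)) U := A₃.contDiff.comp_contDiffOn hQ
  have hT₃ : ContDiffOn ℝ (2 : ℕ) (fun y ↦ (A₃ (Q y)).comp (A₂ (Q y))) U := hP₃.clm_comp hT₂
  have hmU : ∀ {f : E → E →L[ℝ] E →L[ℝ] ℝ}, ContDiffOn ℝ (2 : ℕ) f U → ContDiffAt ℝ m f x :=
    fun hf ↦ (hf.contDiffAt (hU.mem_nhds hx)).of_le (by exact_mod_cast hm)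
  -- derivatives of the Jacobian: `‖Dⁱ Q(x)‖ = ‖Dⁱ⁺¹ P(x)‖ ≤ ε`, and of the linear terms
  have hQb : ∀ i, i ≤ 2 → ‖iteratedFDeriv ℝ i Q x‖ ≤ ε := fun i hi ↦ by
    rw [hQdef, norm_iteratedFDeriv_fderiv_of_isOpen hU hx i]
    exact hPb (i + 1) (by omega) (by omega)
  have hT₁b : ‖iteratedFDeriv ℝ m (fun y ↦ A₁ (Q y)) x‖ ≤ ‖β‖ * ε :=
    (norm_iteratedFDeriv_const_clm_comp_le hU hQ A₁ hx hm).trans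
      (mul_le_mul hA₁n (hQb m hm) (norm_nonneg _) (norm_nonneg _))
  have hT₂b : ∀ i, i ≤ 2 → ‖iteratedFDeriv ℝ i (fun y ↦ A₂ (Q y)) x‖ ≤ ‖β‖ * ε := fun i hi ↦
    (norm_iteratedFDeriv_const_clm_comp_le hU hQ A₂ hx hi).trans
      (mul_le_mul hA₂n (hQb i hi) (norm_nonneg _) (norm_nonneg _))
  have hP₃b : ∀ i, i ≤ 2 → ‖iteratedFDeriv ℝ i (fun y ↦ A₃ (Q y)) x‖ ≤ ε := fun i hi ↦
    (norm_iteratedFDeriv_const_clm_comp_le hU hQ A₃ hx hi).trans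
      ((mul_le_mul hA₃n (hQb i hi) (norm_nonneg _) zero_le_one).trans_eq (one_mul ε))
  -- the bilinear term, by the Leibniz rule
  have hT₃b : ‖iteratedFDeriv ℝ m (fun y ↦ (A₃ (Q y)).comp (A₂ (Q y))) x‖ ≤ 4 * ‖β‖ * ε := by
    refine (norm_iteratedFDeriv_clm_comp_le hU hP₃ hT₂ hx hm).trans ?_
    have hterm : ∀ i ∈ Finset.range (m + 1),
        (m.choose i : ℝ) * ‖iteratedFDeriv ℝ i (fun y ↦ A₃ (Q y)) x‖ *
          ‖iteratedFDeriv ℝ (m - i) (fun y ↦ A₂ (Q y)) x‖ ≤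
        (m.choose i : ℝ) * (ε * (‖β‖ * ε)) := by
      intro i hi
      have hi' : i ≤ m := Nat.lt_succ_iff.mp (Finset.mem_range.mp hi)
      rw [mul_assoc]
      refine mul_le_mul_of_nonneg_left ?_ (by positivity)
      exact mul_le_mul (hP₃b i (hi'.trans hm)) (hT₂b (m - i) (by omega)) (norm_nonneg _) hε0
    refine (Finset.sum_le_sum hterm).trans ?_
    rw [← Finset.sum_mul, sum_range_choose_real]
    have h2m : (2 : ℝ) ^ m ≤ 4 := by
      calc (2 : ℝ) ^ m ≤ 2 ^ 2 := pow_le_pow_right₀ (by norm_num) hm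
        _ = 4 := by norm_num
    have hεε : ε * ε ≤ ε := mul_le_of_le_one_left hε0 hε1
    calc (2 : ℝ) ^ m * (ε * (‖β‖ * ε)) = 2 ^ m * (ε * ε * ‖β‖) := by ring
      _ ≤ 4 * (ε * ‖β‖) := by gcongr
      _ = 4 * ‖β‖ * ε := by ring
  -- on `U`: `DS = 1 + Q`, whence the pointwise decomposition of `bilinPullback S β - β`, which
  -- therefore has the same iterated derivatives at `x`
  have hident : ∀ y ∈ U, bilinPullback (fun z ↦ z + P z) (fun _ ↦ β) y - β =
      A₁ (Q y) + A₂ (Q y) + (A₃ (Q y)).comp (A₂ (Q y)) := by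
    intro y hy
    change (ContinuousLinearMap.precomp ℝ (fderiv ℝ (fun z ↦ z + P z) y)).comp
        (β.comp (fderiv ℝ (fun z ↦ z + P z) y)) - β = _
    rw [fderiv_id_add_eq hU hP hy]
    exact precomp_comp_id_add_sub_eq β (Q y)
  have hev : (fun y ↦ bilinPullback (fun z ↦ z + P z) (fun _ ↦ β) y - β) =ᶠ[𝓝 x]
      (fun y ↦ A₁ (Q y) + A₂ (Q y) + (A₃ (Q y)).comp (A₂ (Q y))) :=
    Filter.eventuallyEq_of_mem (hU.mem_nhds hx) hident
  -- conclusion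
  have hβε : 0 ≤ ‖β‖ * ε := mul_nonneg (norm_nonneg β) hε0
  rw [(hev.iteratedFDeriv ℝ m).eq_of_nhds,
    iteratedFDeriv_add_three_apply (hmU hT₁) (hmU hT₂) (hmU hT₃)]
  calc ‖iteratedFDeriv ℝ m (fun y ↦ A₁ (Q y)) x + iteratedFDeriv ℝ m (fun y ↦ A₂ (Q y)) x +
        iteratedFDeriv ℝ m (fun y ↦ (A₃ (Q y)).comp (A₂ (Q y))) x‖
      ≤ ‖iteratedFDeriv ℝ m (fun y ↦ A₁ (Q y)) x‖ + ‖iteratedFDeriv ℝ m (fun y ↦ A₂ (Q y)) x‖ +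
        ‖iteratedFDeriv ℝ m (fun y ↦ (A₃ (Q y)).comp (A₂ (Q y))) x‖ := norm_add₃_le
    _ ≤ ‖β‖ * ε + ‖β‖ * ε + 4 * ‖β‖ * ε := add_le_add_three hT₁b (hT₂b m hm) hT₃b
    _ ≤ 8 * ‖β‖ * ε := by linarith

end General

/-- **W2 — pull-back of a constant form along a `C³`-near-identity map, proved**: the general
normed-space estimate `norm_iteratedFDeriv_bilinPullback_id_add_const_sub_le`, specialised to
`E4`. [folklore] -/
theorem stub_bilinPullbackNearIdConst : Literature.Uncategorized.BilinPullbackNearIdConst :=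
  fun β _ _ _ _ hU hx hP hε0 hε1 hPb _ hm ↦
    norm_iteratedFDeriv_bilinPullback_id_add_const_sub_le β hU hx hP hε0 hε1 hPb hm

end Summit.FinalStateConjecture.FinalStateConjecture.Theorems.NeckGapDecay.ConnectionLevelCones.BilinPullbackNearIdConstStub
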